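import Literature.MathematicalPhysics.QuantumFieldTheory.Balaban1983to89.B14Eq216Concrete
import Literature.MathematicalPhysics.QuantumFieldTheory.Balaban1983to89.B15Chi124DetSets

/-!
# `Balaban1983to89.B15Sect1Instances` — T. Bałaban, *Large field renormalization. I. The basic step of the 𝐑 operation*,
# Commun. Math. Phys. **122** (1989) 175–202 [Balaban1989LargeFieldI] = «[IV]», §1: PRINT'S OWN INSTANCES of the background
# configurations (1.19)–(1.21), (1.26), (1.74), (1.79), of the function (1.77), and of the characteristic functions
# (1.22)–(1.24), (1.27), (1.53), (1.75) — r12's parametrised definitions (`B15DeterminingSets`, `B15.PrelimIntegrations`,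
# `B15Chi124DetSets`) taken AT the localized determining set `𝔹_k(Z) := 𝐁_k(Z)` of [III] (2.13) (r11's
# `B14.Eq213DetSet.Bj M₁ Z k`) and AT the pull-back `Q_k^{s*} := qsstarGIter0 k` of [III] (1.3) (p31), on the torus carrier
# of record `T_η = Site P 0`

statement-level skeleton of published theorems with citation tags; proofs where landed; nothing here is a claim about
the Yang–Mills mass gap

PDF held: `paper:balaban1989-cmp122-large-field-i` (journal page = PDF page + 174); pp. 180–182, 187, 192–195 read on the text
layer `p0006`–`p0008`, `p0013`, `p0018`–`p0021` (displays whose OCR is garbled taken from r12's render-verified quotations in the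
docstrings of `B15DeterminingSets` / `B15.PrelimIntegrations` / `B15Chi124DetSets`, QUOTE-AUDIT-B15 2026-08-22).  [III] = T. Bałaban,
*Convergent renormalization expansions for lattice gauge theories*, Commun. Math. Phys. **119** (1988) 243–285
[Balaban1988Convergent].

CITATION HEADER / WHAT IS REPRODUCED (mega-formalization `lit-balaban`, HOME `run/shared/lean/pub/lit-balaban/`; unit
`lit-balaban-r11` gen 109 = the owner of block B14 = [III], acting under the free-target protocol G.5-34 (d) on block B15,
whose fold owner r12 is auto-wake-gated; companion document `lit-balaban-r11/READING-RULE-PREAUDIT-B15-r11-g109.md` §3).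
SKELETON rows served (cells; heads are the lead's / the PROXY file's business): **B15.Eq1.19–1.20, B15.Eq1.21, B15.Eq1.22,
B15.Eq1.23, B15.Eq1.24, B15.Eq1.26, B15.Eq1.27, B15.Eq1.53, B15.Eq1.74, B15.Eq1.75, B15.Eq1.77, B15.Eq1.79**.

WHY.  r12 typed these displays in gen 2 (p243299) / gen 1 (p239014) / gen 12 (p311723) WITH BODY but with two printed objects as
explicit parameters, because the tree then lacked them: the localized determining set `𝔹_k(Z)` of [III] (2.13)/(2.16)
(argument `BkZ`) and the map `V_k ↦ Q_k^{s*}V_k` of [III] (1.3) with `k`-blocks (argument `Qs`).  Both objects now exist on the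
carrier of record: `B14.Eq213DetSet.Bj M₁ X k` (r11, p363492; [III] (2.13) `𝐁_k(X) = genSet (maxDomT M₁ X) k`) and
`BIJ85Eq453GaugeField.qsstarGIter0 k` (p31, p248815; its printed `k`-block case formula `B14.Eq216Concrete.qsstarGIter0_eq`).  r11's
`B14.Eq216Concrete.ukBox_eq_bgKZ` (p365333) already records that [III] (2.16) `U_{k,□}(V_k)` IS r12's (1.74) shape `bgKZ` at
`𝐁_k(□^{∼4})`, `qsstarGIter0 k` (`rfl`).  This file writes the [IV] instances themselves — the domain is the large-field region
`Z` ([IV] p. 180, p. 192) instead of the cube `□^{∼4}` — and threads them through (1.19)–(1.27), (1.53), (1.75), (1.77), (1.79),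
so that each of these displays is typed at PRINT'S OWN instance (the lead's READING RULE FOR DEFINITION DISPLAYS, clause (a)).
Every `theorem` is a definitional unfolding or a one-line consequence of r12's API; no `Prop` fact, no `sorry`, no new axiom;
nothing of r12's files is restated (their declarations are USED by name).

READING (declared, not new).  As in `B15DeterminingSets`: regions `Ω_j, Z, Z″_j, Λ ⊂ T_η = Site P 0`; `X^{(j)} = pts j X`;
bonds meeting a point set = `bondsOf`; `|U(∂p) − 1| = dist1 (plaqHol U p)`; *"p ∈ X"* for a region = `B8Eq17ClassAkV1.plaqsOf X`
(the [I] p. 251 convention, as in `B15Chi124DetSets`); the [III] (2.12) solution map `U(𝐁, ·)` = DATA `DetBackground` ([15]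
Thm 1 = row B11.Thm1, not asserted); `M^j = Averaging.iter av j`, `M˙ = avgFamily av`.  p. 192 *"It is defined in each
component of Z separately"*: `maxDomT`/`Bj` are built cube-locally, so for a region `Z` whose components are far apart the
construction IS componentwise; print's per-component bookkeeping is not modelled beyond that (recorded, as in r12's files).
-/

noncomputable section

namespace Literature.MathematicalPhysics.QuantumFieldTheory.Balaban1983to89.B15Sect1Instances

open Literature.MathematicalPhysics.QuantumFieldTheory.Balaban1983to89
open B15DeterminingSets B14.Eq213DetSet B14.Eq216Concrete B15.PrelimIntegrations B15Chi124DetSets B8Eq17ClassAkV1 GaugeField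
open Literature.MathematicalPhysics.QuantumFieldTheory.BalabanImbrieJaffe1984to88.BIJ85Eq453GaugeField
open Set

variable {P : Params} {G : Type*} [GaugeGroup G] {av : ∀ j, Averaging P j G} (bg : DetBackground P G av) (M₁ : ℕ)

/-! ## §1  (1.74): `U_{k,Z}(V_k) = U(𝔹_k(Z), M˙(Q_k^{s*}V_k))` at print's instance -/

section Eq174

/-- **(1.74)** p. 192 [PDF 18], verbatim: *"Take the function U_{k,Z}(V_k) given by U_{k,Z} = U_{k,Z}(V_k) = U(𝔹_k(Z),
M˙(Q_k^{s*}V_k)). (1.74) This function is also important for subsequent constructions. It is defined in each component of Z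
separately."* — r12's `bgKZ` AT print's instance: `𝔹_k(Z) := Bj M₁ Z k` ([III] (2.13), r11) and `Q_k^{s*} := qsstarGIter0 k`
([III] (1.3) with `k`-blocks, p31). [cite: Balaban1989LargeFieldI, (1.74) p.192] -/
def bgKZstd (Z : Set (Site P 0)) (k : ℕ) (Vk : GaugeField P k G) : GaugeField P 0 G :=
  bgKZ bg (Bj M₁ Z k) (qsstarGIter0 k) Vk

/-- Unfolding of (1.74) at print's instance: `U_{k,Z}(V_k) = U(𝐁_k(Z), M˙(Q_k^{s*}V_k))`. [cite: Balaban1989LargeFieldI, (1.74) p.192] -/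
theorem bgKZstd_apply (Z : Set (Site P 0)) (k : ℕ) (Vk : GaugeField P k G) :
    bgKZstd bg M₁ Z k Vk = bg.U (Bj M₁ Z k) (avgFamily av (qsstarGIter0 k Vk)) := rfl

/-- (1.74) is r12's parametrised shape `bgKZ` at `(Bj M₁ Z k, qsstarGIter0 k)` (definitional). [cite: Balaban1989LargeFieldI, (1.74) p.192] -/
theorem bgKZstd_eq_bgKZ (Z : Set (Site P 0)) (k : ℕ) : bgKZstd bg M₁ Z k = bgKZ bg (Bj M₁ Z k) (qsstarGIter0 k) := rfl

/-- **[III] (2.16) IS [IV] (1.74) with the domain `Z := □^{∼4}`**: r11's `B14.Eq216Concrete.ukBox bg M₁ □4 k = bgKZstd bg M₁ □4 k`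
(definitional; cf. `ukBox_eq_bgKZ`). [cite: Balaban1989LargeFieldI, (1.74) p.192; Balaban1988Convergent, (2.16) p.257] -/
theorem bgKZstd_eq_ukBox (box4 : Set (Site P 0)) (k : ℕ) : bgKZstd bg M₁ box4 k = ukBox bg M₁ box4 k := rfl

/-- `U_{k,Z}(V_k)` IS a minimal configuration of the [III] (2.12) problem for `𝐁_k(Z)` and the data `M˙(Q_k^{s*}V_k)` (for data
in the domain of the solution map). [cite: Balaban1989LargeFieldI, (1.74) p.192; Balaban1988Convergent, (2.12) p.256] -/
theorem isMinimizer_bgKZstd {Z : Set (Site P 0)} {k : ℕ} {Vk : GaugeField P k G}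
    (hV : avgFamily av (qsstarGIter0 k Vk) ∈ bg.dom (Bj M₁ Z k)) :
    IsMinimizer av bg.reg (Bj M₁ Z k) (avgFamily av (qsstarGIter0 k Vk)) (bgKZstd bg M₁ Z k Vk) :=
  bg.isMinimizer _ _ hV

end Eq174

/-! ## §2  (1.19)–(1.21), (1.26): the localized determining sets `𝔹_k^{(n)}(Z)` and backgrounds `U^{(n)}_{k,Z}`, `V_Z^{(j)}` -/

section Eq120

variable (Ω Zpp : ℕ → Set (Site P 0)) (Z : Set (Site P 0)) (h k : ℕ)

/-- **(1.19)** p. 180 [PDF 6], verbatim: *"The determining sets 𝔹_k^{(n)}(Z) are defined as above, by the equalities (1.14)–(1.17),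
but the set 𝔹_k ∩ (Ω_k ∪ Zᶜ) is replaced by 𝔹_k(Z) ∩ Ω_k. Thus, according to the definition (2.14) [III], they may be defined as
𝔹_k^{(n)}(Z) = 𝔹_k^{(n)} ∪ 𝔹_k(Z). (1.19)"* — r12's `detSetNZ` AT `𝔹_k(Z) := Bj M₁ Z k`. [cite: Balaban1989LargeFieldI, (1.19) p.180] -/
def detSetNZstd (n : ℕ) : DetSet P := detSetNZ Ω Zpp Z h k n (Bj M₁ Z k)

/-- Unfolding of (1.19) at print's instance: `𝔹_k(Z) ∩ Ω_k` ∪ (the curly bracket of (1.14)–(1.16)) ∪ `𝔹_k ∩ Ω^c_h ∩ Z`,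
scale by scale. [cite: Balaban1989LargeFieldI, (1.19) p.180] -/
theorem detSetNZstd_eq (n : ℕ) :
    detSetNZstd M₁ Ω Zpp Z h k n =
      (Bj M₁ Z k).restrict (Ω k) ∪ fun i => pts i (midRegion Ω Zpp Z h k n i ∪ (gammaRegion Ω k i ∩ ((Ω h)ᶜ ∩ Z))) := rfl

/-- **(1.20)** p. 180, verbatim: *"The corresponding functions are defined by the gauge fields V restricted to Ω^c_k, and by
M_{𝔹_k(Z)}(Q_k^{s*}V_k) restricted to Z ∩ Ω_k, thus U^{(n)}_{k,Z} = U^{(n)}_{k,Z}(V) = U(𝔹_k^{(n)}(Z), (M˙(Q_k^{s*}V_k)↾_{Z∩Ω_k},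
V↾_{Z∩Ω^c_k})). (1.20)"* — r12's `bgNZ` AT `𝔹_k(Z) := Bj M₁ Z k`, `Q_k^{s*} := qsstarGIter0 k`. [cite: Balaban1989LargeFieldI, (1.20) p.180] -/
def bgNZstd (n : ℕ) (V : MSField P G) : GaugeField P 0 G :=
  bgNZ bg Ω Zpp Z h k n (Bj M₁ Z k) (qsstarGIter0 k) V

/-- Unfolding of (1.20) at print's instance: the solution map at `𝔹_k^{(n)}(Z)` and the spliced data `(M˙(Q_k^{s*}V_k)↾_{Z∩Ω_k},
V↾)`. [cite: Balaban1989LargeFieldI, (1.20) p.180] -/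
theorem bgNZstd_apply (n : ℕ) (V : MSField P G) :
    bgNZstd bg M₁ Ω Zpp Z h k n V =
      bg.U (detSetNZstd M₁ Ω Zpp Z h k n) (splice (Z ∩ Ω k) (avgFamily av (qsstarGIter0 k (V k))) V) := rfl

/-- **(1.21)**, second member, p. 181 [PDF 7]: *"U^{(N)}_{k,Z} = U″_{k,Z}"* (`N = k − h`) at print's instance (r12's `bgPPZ`).
[cite: Balaban1989LargeFieldI, (1.21) p.181] -/
def bgPPZstd (V : MSField P G) : GaugeField P 0 G := bgPPZ bg Ω Zpp Z h k (Bj M₁ Z k) (qsstarGIter0 k) V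

/-- `U″_{k,Z} = U^{(k−h)}_{k,Z}` (definitional). [cite: Balaban1989LargeFieldI, (1.21) p.181] -/
theorem bgPPZstd_eq (V : MSField P G) : bgPPZstd bg M₁ Ω Zpp Z h k V = bgNZstd bg M₁ Ω Zpp Z h k (k - h) V := rfl

/-- **(1.26)** p. 182 [PDF 8], verbatim: *"Define the configuration V_Z^{(j)} = M^j(U^{(j+1−h)}_{k,Z}), (1.26)"* — r12's `vZ` AT
print's instance. [cite: Balaban1989LargeFieldI, (1.26) p.182] -/
def vZstd (V : MSField P G) (j : ℕ) : GaugeField P j G := vZ bg Ω Zpp Z h k (Bj M₁ Z k) (qsstarGIter0 k) V j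

/-- Unfolding of (1.26): `V_Z^{(j)} = M^j(U^{(j+1−h)}_{k,Z}(V))`. [cite: Balaban1989LargeFieldI, (1.26) p.182] -/
theorem vZstd_apply (V : MSField P G) (j : ℕ) :
    vZstd bg M₁ Ω Zpp Z h k V j = Averaging.iter av j (bgNZstd bg M₁ Ω Zpp Z h k (j + 1 - h) V) := rfl

end Eq120

/-! ## §3  (1.22)–(1.24), (1.27), (1.53): the characteristic functions at print's configurations -/

section Chi

variable (Ω Zpp : ℕ → Set (Site P 0)) (Z : Set (Site P 0)) (h k : ℕ)

/-- **(1.22)** p. 181 [PDF 7]: `χ_k^{(0)} = χ({|U^{(0)}_{k,Z}(∂p) − 1| < (1 − β½)ε_h(L^{k−h}η)² for p ∈ Ω_h∖Ω_{h+1}})` — r12's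
`chi122` (concrete region) AT the configuration `U^{(0)}_{k,Z}(V)` of (1.20). [cite: Balaban1989LargeFieldI, (1.22) p.181] -/
def chi122std (β : ℝ) (ε : ℕ → ℝ) (L η : ℝ) (V : MSField P G) : Prop :=
  chi122 Ω h k β ε L η (bgNZstd bg M₁ Ω Zpp Z h k 0 V)

/-- (1.22) unfolded at print's instance: the small-plaquette condition on `plaqsOf (Ω_h∖Ω_{h+1})` at the printed threshold for the
configuration `U^{(0)}_{k,Z}(V)`. [cite: Balaban1989LargeFieldI, (1.22) p.181] -/
theorem chi122std_iff (β : ℝ) (ε : ℕ → ℝ) (L η : ℝ) (V : MSField P G) :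
    chi122std bg M₁ Ω Zpp Z h k β ε L η V ↔
      PlaqSmallOn (plaqsOf (Ω h \ Ω (h + 1))) ((1 - β / 2) * E124 ε L η k h) (bgNZstd bg M₁ Ω Zpp Z h k 0 V) :=
  chi122_iff Ω h k β ε L η _

/-- **(1.23)** p. 181: `χ_k^{(1)}` — r12's `chi123` (concrete regions `Z″_{h+1}∩Ω_h`, `Ω^c_{h+2}∖Z″_{h+1}`) AT the configuration
`U^{(1)}_{k,Z}(V)`. [cite: Balaban1989LargeFieldI, (1.23) p.181] -/
def chi123std (β : ℝ) (ε : ℕ → ℝ) (L η : ℝ) (V : MSField P G) : Prop :=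
  chi123 Ω Zpp h k β ε L η (bgNZstd bg M₁ Ω Zpp Z h k 1 V)

/-- (1.23) unfolded at print's instance (`h < k`, `L ≠ 0`). [cite: Balaban1989LargeFieldI, (1.23) p.181] -/
theorem chi123std_iff {h k : ℕ} (hhk : h < k) (β : ℝ) (ε : ℕ → ℝ) {L : ℝ} (hL : L ≠ 0) (η : ℝ) (V : MSField P G) :
    chi123std bg M₁ Ω Zpp Z h k β ε L η V ↔
      PlaqSmallOn (plaqsOf (Zpp (h + 1) ∩ Ω h)) ((1 - β * (1 / 2 + 1 / 2 ^ 2)) * E124 ε L η k h)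
          (bgNZstd bg M₁ Ω Zpp Z h k 1 V) ∧
        PlaqSmallOn (plaqsOf ((Ω (h + 2))ᶜ \ Zpp (h + 1))) ((1 - β / 2) * E124 ε L η k (h + 1))
          (bgNZstd bg M₁ Ω Zpp Z h k 1 V) :=
  chi123_iff Ω Zpp hhk β ε hL η _

/-- **(1.24)** pp. 181–182 [PDF 7–8], second case `j = h + n > k₀`: `χ_k^{(n)}` — r12's `Chi124` (the located lines on the concrete
regions) AT the configuration `U^{(n)}_{k,Z}(V)` of (1.20); its `Z″`- and `Ω`-lines are the rewritten conditions (1.49), (1.51)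
(`B15.BasicStep.SF149`/`SF151`) at that configuration. [cite: Balaban1989LargeFieldI, (1.24) p.182] -/
def chi124std (k₀ n : ℕ) (β L₀ : ℝ) (ε : ℕ → ℝ) (L η : ℝ) (V : MSField P G) : Prop :=
  Chi124 Ω Zpp h k₀ (h + n) k β L₀ ε L η (bgNZstd bg M₁ Ω Zpp Z h k n V)

/-- (1.24) unfolded at print's instance: every line is `Setup.PlaqSmallOn` on the plaquettes of its region at the printed threshold,
for the configuration `U^{(n)}_{k,Z}(V)`. [cite: Balaban1989LargeFieldI, (1.24) p.182] -/
theorem chi124std_iff (k₀ n : ℕ) (β L₀ : ℝ) (ε : ℕ → ℝ) (L η : ℝ) (V : MSField P G) :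
    chi124std bg M₁ Ω Zpp Z h k k₀ n β L₀ ε L η V ↔
      (∀ i, h ≤ i → i < h + n → PlaqSmallOn (plaqsOf (region149 Ω Zpp h i))
          ((1 - β * (1 - (1 / 2 : ℝ) ^ (h + n - i + 1))) * (L₀ ^ 2) ^ (i - k₀ - 1) * E124 ε L η k i)
          (bgNZstd bg M₁ Ω Zpp Z h k n V)) ∧
      PlaqSmallOn (plaqsOf ((Ω (k₀ + 1))ᶜ \ Zpp (h + n))) ((1 - β / 2) * (L₀ ^ 2) ^ (h + n - k₀ - 1) * E124 ε L η k (h + n))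
          (bgNZstd bg M₁ Ω Zpp Z h k n V) ∧
      (∀ l, k₀ < l → l + 2 ≤ h + n → PlaqSmallOn (plaqsOf (Ω l \ Ω (l + 1)))
          ((1 - β / 2) * L₀ ^ (2 * (h + n - l - 1)) * E124 ε L η k (h + n)) (bgNZstd bg M₁ Ω Zpp Z h k n V)) ∧
      PlaqSmallOn (plaqsOf (Ω (h + n - 1) \ Ω (h + n + 1))) (cTop (h + n) k * (1 - β / 2) * E124 ε L η k (h + n))
          (bgNZstd bg M₁ Ω Zpp Z h k n V) :=
  chi124_iff Ω Zpp h k₀ (h + n) k β L₀ ε L η _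

/-- At `n = N = k − h` (so `j = k`) the function `χ_k^{(N)} = χ″_k` of (1.88)/(1.89) is `Chi124` at `j = k` for the last background
`U″_{k,Z}` of (1.21) (`h ≤ k`). [cite: Balaban1989LargeFieldI, (1.24) p.182, (1.21) p.181] -/
theorem chi124std_top {h k : ℕ} (hhk : h ≤ k) (k₀ : ℕ) (β L₀ : ℝ) (ε : ℕ → ℝ) (L η : ℝ) (V : MSField P G) :
    chi124std bg M₁ Ω Zpp Z h k k₀ (k - h) β L₀ ε L η V ↔
      Chi124 Ω Zpp h k₀ k k β L₀ ε L η (bgPPZstd bg M₁ Ω Zpp Z h k V) := by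
  have hk : h + (k - h) = k := by omega
  simp only [chi124std, hk, bgPPZstd_eq]

/-- **(1.27)** p. 182 [PDF 8], verbatim: *"χ′_j = χ({|V_j(b)(V^{(j)}_Z(b))^{−1} − 1| < 2δ′_j for b ∈ (Ω^c_{j+1}∖Z″_{j+1})^{(j)*}})"* —
r12's letter-level `SF127` AT print's instance: the bond set = the bonds of `T^{(j)}` meeting `(Ω^c_{j+1}∖Z″_{j+1})^{(j)}`
(`bondsOf (pts j …)`), the tested field = the integration variable `V_j`, the reference field = `V_Z^{(j)}` of (1.26) at print's
instance; `δ′_j` is the number of (1.27)/p. 183 (`δ′_j = g_jA₁p₁(g_j)`, along a flow `B15Ineq194Flow.deltaPrimeK`).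
[cite: Balaban1989LargeFieldI, (1.27) p.182] -/
def chi127std (δ'j : ℝ) (V : MSField P G) (j : ℕ) : Prop :=
  SF127 (bondsOf (pts j ((Ω (j + 1))ᶜ \ Zpp (j + 1)))) δ'j (V j) (vZstd bg M₁ Ω Zpp Z h k V j)

/-- (1.27) unfolded at print's instance. [cite: Balaban1989LargeFieldI, (1.27) p.182] -/
theorem chi127std_iff (δ'j : ℝ) (V : MSField P G) (j : ℕ) :
    chi127std bg M₁ Ω Zpp Z h k δ'j V j ↔
      ∀ b ∈ bondsOf (pts j ((Ω (j + 1))ᶜ \ Zpp (j + 1))),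
        dist1 (V j b * (vZstd bg M₁ Ω Zpp Z h k V j b)⁻¹) < 2 * δ'j := Iff.rfl

/-- **(1.53)** p. 187 [PDF 13], verbatim: *"We introduce the fluctuation field V′_j on (Ω^c_{j+1}∖Z″_j)^{(j)}, V′_j = V_j(V^{(j)})^{−1},
V^{(j)} = M^j(U_k^{(n+1)})"* — r12's bondwise quotient `fluct153` AT print's instance `V^{(j)} := M^j(U_k^{(n+1)}(V))` with the
background (1.18) `bgN`. [cite: Balaban1989LargeFieldI, (1.53) p.187] -/
def fluct153std (n : ℕ) (V : MSField P G) (j : ℕ) : GaugeField P j G :=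
  fluct153 (V j) (Averaging.iter av j (bgN bg Ω Zpp Z h k (n + 1) V))

/-- (1.53) unfolded bondwise: `V′_j(b) = V_j(b)·(M^j(U_k^{(n+1)}(V))(b))⁻¹`. [cite: Balaban1989LargeFieldI, (1.53) p.187] -/
theorem fluct153std_apply (n : ℕ) (V : MSField P G) (j : ℕ) (b : PBond P j) :
    fluct153std bg Ω Zpp Z h k n V j b = V j b * (Averaging.iter av j (bgN bg Ω Zpp Z h k (n + 1) V) b)⁻¹ := rfl

/-- **(1.54)**, first step, at print's instances: `|V′_j(b) − 1| ≤ |V_j(b)(V_Z^{(j)}(b))^{−1} − 1| + |V_Z^{(j)}(b)(V^{(j)}(b))^{−1} − 1|`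
(r12's `dist1_fluct_le` with `V_Z^{(j)} := vZstd`). [cite: Balaban1989LargeFieldI, (1.54) p.187] -/
theorem dist1_fluct153std_le (n : ℕ) (V : MSField P G) (j : ℕ) (b : PBond P j) :
    dist1 (fluct153std bg Ω Zpp Z h k n V j b) ≤
      dist1 (V j b * (vZstd bg M₁ Ω Zpp Z h k V j b)⁻¹) +
        dist1 (vZstd bg M₁ Ω Zpp Z h k V j b * (Averaging.iter av j (bgN bg Ω Zpp Z h k (n + 1) V) b)⁻¹) :=
  dist1_fluct_le _ _ _

end Chi

/-! ## §4  (1.75), (1.77), (1.79): the function `χ_{k,Λ}`, the variational function and the background `U₀` at print's instance -/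

section Lambda

variable (Z Λ : Set (Site P 0)) (k : ℕ)

/-- The extensions of p. 193: *"The restriction introduced by this function is on the field V_k↾_{Z∩Λ^c} only. It means that this
field has an extension on the whole domain Z"* — the scale-`k` fields agreeing with the given `V_k` off the bonds meeting `Λ^{(k)}`.
[cite: Balaban1989LargeFieldI, (1.75) p.193] -/
def Ext175 (Vk : GaugeField P k G) : Type _ := {W : GaugeField P k G // ∀ b, b ∉ bondsOf (pts k Λ) → W b = Vk b}

/-- **(1.75)** p. 193 [PDF 19], verbatim: *"χ_{k,Λ} = χ({inf_{V_k↾_Λ} sup_{p∈Ω^c_k} |U_{k,Z}(∂p) − 1| < 2ε_kη²})"* — r12's existential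
form `Chi175` AT print's instance: extensions `Ext175` of `V_k↾_{Z∩Λ^c}`, deviation `|U_{k,Z}(∂p) − 1|` through (1.74) `bgKZstd`,
plaquette range `plaqsOf (Ω_k)ᶜ`. [cite: Balaban1989LargeFieldI, (1.75) p.193] -/
def chi175std (Ω : ℕ → Set (Site P 0)) (εk η : ℝ) (Vk : GaugeField P k G) : Prop :=
  Chi175 (fun (W : Ext175 Λ k Vk) (p : Plaq P 0) => dist1 (plaqHol (bgKZstd bg M₁ Z k W.1) p)) (plaqsOf (Ω k)ᶜ) εk η

/-- (1.75) unfolded at print's instance: SOME extension `W` of `V_k↾_{Z∩Λ^c}` has `|U_{k,Z}(W)(∂p) − 1| < 2ε_kη²` for every plaquette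
meeting `Ω^c_k`. [cite: Balaban1989LargeFieldI, (1.75) p.193] -/
theorem chi175std_iff (Ω : ℕ → Set (Site P 0)) (εk η : ℝ) (Vk : GaugeField P k G) :
    chi175std bg M₁ Z Λ k Ω εk η Vk ↔
      ∃ W : GaugeField P k G, (∀ b, b ∉ bondsOf (pts k Λ) → W b = Vk b) ∧
        PlaqSmallOn (plaqsOf (Ω k)ᶜ) (2 * εk * η ^ 2) (bgKZstd bg M₁ Z k W) := by
  constructor
  · rintro ⟨W, hW⟩
    exact ⟨W.1, W.2, hW⟩
  · rintro ⟨W, hWb, hW⟩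
    exact ⟨⟨W, hWb⟩, hW⟩

/-- **(1.77)** p. 194 [PDF 20], verbatim: *"Consider the function V_k↾_Λ → A(U_{k,Z}(V_k)). (1.77)"* — r12's `fun177` AT print's
instance (the Wilson action `Setup.wilsonAction4` of (1.74)). [cite: Balaban1989LargeFieldI, (1.77) p.194] -/
def fun177std (Vk : GaugeField P k G) : ℝ := fun177 bg (Bj M₁ Z k) (qsstarGIter0 k) Vk

/-- (1.77) unfolded: `A(U_{k,Z}(V_k)) = wilsonAction4 (bgKZstd … V_k)`. [cite: Balaban1989LargeFieldI, (1.77) p.194] -/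
theorem fun177std_eq (Vk : GaugeField P k G) : fun177std bg M₁ Z k Vk = wilsonAction4 (bgKZstd bg M₁ Z k Vk) := rfl

/-- Proposition 1's minimizer `V_Λ = V_Λ(V_k↾_{Z∩Λᶜ})` of (1.77) over the variables `V_k↾_Λ` (the bonds meeting `Λ^{(k)}`), at print's
instance (r12's `IsVLambda`; existence/uniqueness = row B15.Prop1, [Balaban1989LargeFieldII] pp. 358–359, NOT asserted).
[cite: Balaban1989LargeFieldI, Prop. 1 (1.78) p.194] -/
def IsVLambdaStd (Vout VΛ : GaugeField P k G) : Prop :=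
  IsVLambda bg (Bj M₁ Z k) (qsstarGIter0 k) (bondsOf (pts k Λ)) Vout VΛ

/-- `IsVLambdaStd` unfolded: `V_Λ = V_k` off `Λ` and `A(U_{k,Z}(V_Λ)) ≤ A(U_{k,Z}(W))` for every competitor `W = V_k` off `Λ`.
[cite: Balaban1989LargeFieldI, Prop. 1 (1.78) p.194] -/
theorem isVLambdaStd_iff (Vout VΛ : GaugeField P k G) :
    IsVLambdaStd bg M₁ Z Λ k Vout VΛ ↔
      (∀ b, b ∉ bondsOf (pts k Λ) → VΛ b = Vout b) ∧
        ∀ W : GaugeField P k G, (∀ b, b ∉ bondsOf (pts k Λ) → W b = Vout b) →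
          fun177std bg M₁ Z k VΛ ≤ fun177std bg M₁ Z k W := Iff.rfl

/-- **(1.79)** p. 195 [PDF 21], verbatim: *"Extend the function V_Λ on the whole domain Z putting V_Λ = V_k on Z ∩ Λᶜ, and define
U₀ = U_{k,Z}(V_Λ). (1.79) This is a fundamental background field"* — r12's `bgU0` AT print's instance. [cite: Balaban1989LargeFieldI, (1.79) p.195] -/
def bgU0std (VΛ : GaugeField P k G) : GaugeField P 0 G := bgU0 bg (Bj M₁ Z k) (qsstarGIter0 k) VΛ

/-- (1.79) unfolded: `U₀ = U_{k,Z}(V_Λ)` is (1.74) at `V_Λ`. [cite: Balaban1989LargeFieldI, (1.79) p.195] -/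
theorem bgU0std_eq (VΛ : GaugeField P k G) : bgU0std bg M₁ Z k VΛ = bgKZstd bg M₁ Z k VΛ := rfl

/-- (1.79) with Proposition 1, at print's instance: `A(U₀)` is the minimum of (1.77) over the fields agreeing with `V_k` off `Λ`
(r12's `wilsonAction4_bgU0_le`). [cite: Balaban1989LargeFieldI, (1.79) p.195] -/
theorem wilsonAction4_bgU0std_le {Vout VΛ : GaugeField P k G} (hV : IsVLambdaStd bg M₁ Z Λ k Vout VΛ)
    (W : GaugeField P k G) (hW : ∀ b, b ∉ bondsOf (pts k Λ) → W b = Vout b) :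
    wilsonAction4 (bgU0std bg M₁ Z k VΛ) ≤ fun177std bg M₁ Z k W :=
  wilsonAction4_bgU0_le bg hV W hW

/-- A minimizer is its own admissible extension for (1.75): if `V_Λ` realises `|U₀(∂p) − 1| < 2ε_kη²` on the plaquettes meeting
`Ω^c_k`, then `χ_{k,Λ} = 1` at the boundary datum `V_k↾_{Z∩Λᶜ}` (the direction print uses on p. 195, *"U₀ belongs to the
integration domain"* being the deferred Claim@195). [cite: Balaban1989LargeFieldI, (1.75) p.193, (1.79) p.195] -/
theorem chi175std_of_isVLambdaStd (Ω : ℕ → Set (Site P 0)) {εk η : ℝ} {Vout VΛ : GaugeField P k G}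
    (hV : IsVLambdaStd bg M₁ Z Λ k Vout VΛ)
    (hU0 : PlaqSmallOn (plaqsOf (Ω k)ᶜ) (2 * εk * η ^ 2) (bgU0std bg M₁ Z k VΛ)) :
    chi175std bg M₁ Z Λ k Ω εk η Vout :=
  (chi175std_iff bg M₁ Z Λ k Ω εk η Vout).2 ⟨VΛ, hV.1, hU0⟩

end Lambda

end Literature.MathematicalPhysics.QuantumFieldTheory.Balaban1983to89.B15Sect1Instances

end
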